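import Mathlib.Analysis.Complex.Basic
import Mathlib.Analysis.Calculus.ContDiff.Operations
import Literature.Topology.FourManifolds.GluingConstruction
import Literature.Topology.FourManifolds.GluingUniqueness
import Literature.Topology.FourManifolds.CorkDecompositionSplittingProof
import HarnessLib

/-!
# The toric model of the blow-up of `ℂℙ¹ × ℂ` at a point, and its monomial involution

This file builds, by two successive open gluings (`Literature.Topology.FourManifolds.SmoothGlueData`,
`GluingConstruction.lean`), the smooth real 4-manifold `Ṽ` underlying the toric surface
`Bl_p(ℂℙ¹ × ℂ)`, `p = (∞, 0)`, from its three affine toric charts `U₁ U₂ U₃ ≅ ℂ²`, and the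
involution `Ψ : Ṽ → Ṽ` induced by the automorphism `L = [[-1,-1],[0,1]]` of its fan. In torus
coordinates `(z, w) ∈ (ℂˣ)²` the charts are

* `U₁` with coordinates `(z, w)`,
* `U₂` with coordinates `(u, m) = (z⁻¹, z w)` (so `w = u m`; `{u = 0}` is the exceptional curve),
* `U₃` with coordinates `(k, w) = ((z w)⁻¹, w)` (so `u = k w`; `{w = 0}` is the exceptional curve),

glued by the monomial transition maps `(z, w) ↦ (z⁻¹, z w)` on `{z ≠ 0}` and
`(u, m) ↦ (m⁻¹, m u)` on `{m ≠ 0}`, and the involution is `(z, w) ↦ ((z w)⁻¹, w)`: it exchanges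
the charts `U₁` and `U₃` identically in coordinates and acts on `U₂` by the coordinate swap
`(u, m) ↦ (m, u)`. It exchanges the exceptional curve with the proper transform of the fibre
`ℂℙ¹ × {0}` (the elementary transformation of the ruled surface, written as an automorphism
of the blow-up). These are the standard facts of toric geometry for the fan with rays
`(1,0), (0,1), (-1,1), (-1,0)` in the upper half plane (Fulton, *Introduction to toric
varieties* (1993), §1.1 (affine toric charts and their gluing), §2.4 (blow-up = star
subdivision); Oda, *Convex bodies and algebraic geometry* (1988), §1.7 (elementary
transformations)). Only the underlying real-smooth structure is used.

## Main definitions and results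

* `ToricBlowup.glue₁₂`, `ToricBlowup.V₁₂`: the first gluing `U₁ ∪ U₂`; Hausdorff
  (`instT2SpaceV₁₂`: the graph `{z u = 1, m = z w}` is closed).
* `ToricBlowup.glue₃`, `ToricBlowup.Model` (`Ṽ`): the second gluing `(U₁ ∪ U₂) ∪ U₃`; Hausdorff.
* `ToricBlowup.Φ₁ Φ₂ Φ₃ : ℂ × ℂ → Model`: the three toric charts, open smooth embeddings covering
  `Model`, with the transition identities `Φ₁_eq_Φ₂`, `Φ₂_eq_Φ₃`, `Φ₁_eq_Φ₃` and the
  injectivity relations `Φ₁_eq_Φ₂_iff`, `Φ₂_eq_Φ₃_iff`, `Φ₁_eq_Φ₃_iff`.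
* `ToricBlowup.Ψ : Model → Model`, `Ψ_Φ₁ : Ψ (Φ₁ p) = Φ₃ p`, `Ψ_Φ₂ : Ψ (Φ₂ (u, m)) = Φ₂ (m, u)`,
  `Ψ_Φ₃ : Ψ (Φ₃ p) = Φ₁ p`, `Ψ_Ψ : Ψ (Ψ v) = v`, `contMDiff_Ψ`, and the diffeomorphism
  `ToricBlowup.ΨDiffeo`.

## Purpose

This is the first file of the proof that Gluck twists dissolve after one connected sum with
`ℂℙ²` (`Literature/Barriers/SmoothPoincare4/GluckTwistsDissolve.lean`): `Model` is
`(S² × ℝ²) # ℂℙ²` (unoriented), and on the end `S² × {‖w‖ > R}` the involution `Ψ` is Gluck's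
map `(x, w) ↦ (rot_{w/‖w‖} x, w)` up to a dilation of `S²` and the half-turn `z ↦ 1/z`; so `Ψ`
extends the Gluck twist of the end over `(S² × ℝ²) # ℂℙ²`, which is the geometric content of
`Σ_K # ℂℙ² ≅ S⁴ # ℂℙ²`.

## Design

The pieces are the normed space `ℂ × ℂ` with its one-chart structure (model `𝓘(ℝ, ℂ × ℂ)`),
so that all smoothness statements reduce to `ContDiff ℝ` of rational maps in two complex
variables (`contDiffAt_inv`). Maps out of the glued spaces are the tree's
`SmoothGlueData.lift` (`CorkDecompositionSplittingProof.lean`), smooth by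
`SmoothGlueData.contMDiff_lift`.
-/

noncomputable section

open scoped Manifold ContDiff Topology
open Set Function

namespace Literature.Topology.FourManifolds

namespace ToricBlowup

/-! ### Calculus of the monomial maps -/

/-- The first transition map `(z, w) ↦ (z⁻¹, z w)` (chart `U₁` to chart `U₂`). [folklore] -/
def τ₁₂ (p : ℂ × ℂ) : ℂ × ℂ := (p.1⁻¹, p.1 * p.2)

/-- The inverse of the first transition map, `(u, m) ↦ (u⁻¹, u m)` — the same formula. [folklore] -/
theorem τ₁₂_τ₁₂ {p : ℂ × ℂ} (hp : p.1 ≠ 0) : τ₁₂ (τ₁₂ p) = p := by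
  obtain ⟨z, w⟩ := p
  simp only [τ₁₂, inv_inv, Prod.mk.injEq, true_and]
  field_simp

/-- The second transition map `(u, m) ↦ (m⁻¹, m u)` (chart `U₂` to chart `U₃`). [folklore] -/
def τ₂₃ (p : ℂ × ℂ) : ℂ × ℂ := (p.2⁻¹, p.2 * p.1)

/-- The inverse of the second transition map, `(k, w) ↦ (k w, k⁻¹)` (chart `U₃` to chart `U₂`).
[folklore] -/
def τ₃₂ (p : ℂ × ℂ) : ℂ × ℂ := (p.1 * p.2, p.1⁻¹)

/-- `τ₃₂ (τ₂₃ (u, m)) = (u, m)` for `m ≠ 0`. [folklore] -/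
theorem τ₃₂_τ₂₃ {p : ℂ × ℂ} (hp : p.2 ≠ 0) : τ₃₂ (τ₂₃ p) = p := by
  obtain ⟨u, m⟩ := p
  simp only [τ₂₃, τ₃₂, inv_inv, Prod.mk.injEq, and_true]
  field_simp

/-- `τ₂₃ (τ₃₂ (k, w)) = (k, w)` for `k ≠ 0`. [folklore] -/
theorem τ₂₃_τ₃₂ {p : ℂ × ℂ} (hp : p.1 ≠ 0) : τ₂₃ (τ₃₂ p) = p := by
  obtain ⟨k, w⟩ := p
  simp only [τ₂₃, τ₃₂, inv_inv, Prod.mk.injEq, true_and]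
  field_simp

/-- `τ₁₂` is smooth off `{z = 0}`. [folklore] -/
theorem contDiffAt_τ₁₂ {p : ℂ × ℂ} (hp : p.1 ≠ 0) : ContDiffAt ℝ ∞ τ₁₂ p :=
  ((contDiffAt_inv ℝ hp).comp p contDiffAt_fst).prodMk (contDiffAt_fst.mul contDiffAt_snd)

/-- `τ₂₃` is smooth off `{m = 0}`. [folklore] -/
theorem contDiffAt_τ₂₃ {p : ℂ × ℂ} (hp : p.2 ≠ 0) : ContDiffAt ℝ ∞ τ₂₃ p :=
  ((contDiffAt_inv ℝ hp).comp p contDiffAt_snd).prodMk (contDiffAt_snd.mul contDiffAt_fst)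

/-- `τ₃₂` is smooth off `{k = 0}`. [folklore] -/
theorem contDiffAt_τ₃₂ {p : ℂ × ℂ} (hp : p.1 ≠ 0) : ContDiffAt ℝ ∞ τ₃₂ p :=
  (contDiffAt_fst.mul contDiffAt_snd).prodMk ((contDiffAt_inv ℝ hp).comp p contDiffAt_fst)

/-! ### The first gluing `U₁ ∪ U₂` -/

/-- The first gluing map as a partial diffeomorphism of `ℂ × ℂ`: `(z, w) ↦ (z⁻¹, z w)` from
`{z ≠ 0}` onto `{u ≠ 0}`, an involution. [folklore] -/
def glue₁₂ : OpenPartialHomeomorph (ℂ × ℂ) (ℂ × ℂ) where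
  toFun := τ₁₂
  invFun := τ₁₂
  source := {p | p.1 ≠ 0}
  target := {p | p.1 ≠ 0}
  map_source' p hp := by simpa [τ₁₂] using hp
  map_target' p hp := by simpa [τ₁₂] using hp
  left_inv' p hp := τ₁₂_τ₁₂ hp
  right_inv' p hp := τ₁₂_τ₁₂ hp
  open_source := isOpen_ne_fun continuous_fst continuous_const
  open_target := isOpen_ne_fun continuous_fst continuous_const
  continuousOn_toFun := fun p hp => (contDiffAt_τ₁₂ hp).continuousAt.continuousWithinAt
  continuousOn_invFun := fun p hp => (contDiffAt_τ₁₂ hp).continuousAt.continuousWithinAt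

/-- The formula of `glue₁₂`. [folklore] -/
@[simp] theorem glue₁₂_apply (p : ℂ × ℂ) : glue₁₂ p = τ₁₂ p := rfl

/-- The formula of `glue₁₂.symm`. [folklore] -/
@[simp] theorem glue₁₂_symm_apply (p : ℂ × ℂ) : glue₁₂.symm p = τ₁₂ p := rfl

/-- The source of `glue₁₂` is `{z ≠ 0}`. [folklore] -/
@[simp] theorem glue₁₂_source : glue₁₂.source = {p : ℂ × ℂ | p.1 ≠ 0} := rfl

/-- The target of `glue₁₂` is `{u ≠ 0}`. [folklore] -/
@[simp] theorem glue₁₂_target : glue₁₂.target = {p : ℂ × ℂ | p.1 ≠ 0} := rfl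

/-- The gluing datum of `U₁ ∪ U₂`. [folklore] -/
def data₁₂ : SmoothGlueData 𝓘(ℝ, ℂ × ℂ) 𝓘(ℝ, ℂ × ℂ) (ℂ × ℂ) (ℂ × ℂ) (ℂ × ℂ) where
  glue := glue₁₂
  contMDiffOn_glue := fun _ hp =>
    (contDiffAt_τ₁₂ hp).contMDiffAt.contMDiffWithinAt
  contMDiffOn_glue_symm := fun _ hp =>
    (contDiffAt_τ₁₂ hp).contMDiffAt.contMDiffWithinAt
  linA := ContinuousLinearEquiv.refl ℝ _
  linB := ContinuousLinearEquiv.refl ℝ _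

/-- The glued space `U₁ ∪ U₂` (an open subset of `Bl_p(ℂℙ¹ × ℂ)`: the complement of the proper
transform of the fibre `{z = ∞}`). [folklore] -/
abbrev V₁₂ : Type := data₁₂.Glued

/-- The graph of the first gluing map is the closed algebraic set `{z u = 1, m = z w}`, so
`U₁ ∪ U₂` is Hausdorff. [folklore] -/
instance instT2SpaceV₁₂ : T2Space V₁₂ := by
  apply data₁₂.t2Space_of_isClosed_graph
  have h : {q : (ℂ × ℂ) × (ℂ × ℂ) | q.1 ∈ data₁₂.glue.source ∧ data₁₂.glue q.1 = q.2} =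
      {q | q.1.1 * q.2.1 = 1 ∧ q.2.2 = q.1.1 * q.1.2} := by
    ext ⟨⟨z, w⟩, ⟨u, m⟩⟩
    simp only [mem_setOf_eq, data₁₂, glue₁₂_source, ne_eq, glue₁₂_apply, τ₁₂, Prod.mk.injEq]
    constructor
    · rintro ⟨hz, rfl, rfl⟩
      exact ⟨mul_inv_cancel₀ hz, rfl⟩
    · rintro ⟨h1, h2⟩
      have hz : z ≠ 0 := left_ne_zero_of_mul_eq_one h1
      exact ⟨hz, (eq_inv_of_mul_eq_one_right h1).symm, h2.symm⟩
  rw [h]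
  exact (isClosed_eq (by fun_prop) continuous_const).inter (isClosed_eq (by fun_prop) (by fun_prop))

/-! ### The second gluing `(U₁ ∪ U₂) ∪ U₃` -/

/-- The second gluing map on representatives: `U₁ ∋ (z, w) ↦ ((z w)⁻¹, w)`,
`U₂ ∋ (u, m) ↦ (m⁻¹, m u)`; total (junk values where `z w = 0`, resp. `m = 0`). [folklore] -/
def glue₃Fun : V₁₂ → ℂ × ℂ :=
  data₁₂.lift (fun p => ((p.1 * p.2)⁻¹, p.2)) τ₂₃ (by
    rintro ⟨z, w⟩ hz
    simp only [data₁₂, glue₁₂_source, mem_setOf_eq] at hz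
    simp only [data₁₂, glue₁₂_apply, τ₁₂, τ₂₃, Prod.mk.injEq, true_and]
    field_simp)

/-- `glue₃Fun` on the first chart. [folklore] -/
@[simp] theorem glue₃Fun_inl (p : ℂ × ℂ) :
    glue₃Fun (data₁₂.inl p) = ((p.1 * p.2)⁻¹, p.2) := rfl

/-- `glue₃Fun` on the second chart. [folklore] -/
@[simp] theorem glue₃Fun_inr (p : ℂ × ℂ) : glue₃Fun (data₁₂.inr p) = τ₂₃ p := rfl

/-- `inl (z, w) = inr (z⁻¹, z w)` in `U₁ ∪ U₂` for `z ≠ 0`. [folklore] -/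
theorem inl_eq_inr₁₂ {p : ℂ × ℂ} (hp : p.1 ≠ 0) : data₁₂.inl p = data₁₂.inr (τ₁₂ p) :=
  (data₁₂.inr_glue (show p ∈ data₁₂.glue.source from hp)).symm

/-- The identification of `U₁ ∪ U₂`: `inl (z, w) = inr (u, m) ↔ z ≠ 0 ∧ u = z⁻¹ ∧ m = z w`.
[folklore] -/
theorem inl_eq_inr₁₂_iff (p q : ℂ × ℂ) :
    data₁₂.inl p = data₁₂.inr q ↔ p.1 ≠ 0 ∧ q = τ₁₂ p := by
  rw [data₁₂.inl_eq_inr_iff]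
  exact Iff.rfl.and eq_comm

/-- The second gluing map as a partial diffeomorphism `U₁ ∪ U₂ ⇀ U₃`: source the image of
`{m ≠ 0} ⊆ U₂`, target `{k ≠ 0} ⊆ U₃`, inverse `(k, w) ↦ inr (k w, k⁻¹)`. [folklore] -/
def glue₃ : OpenPartialHomeomorph V₁₂ (ℂ × ℂ) where
  toFun := glue₃Fun
  invFun := fun q => data₁₂.inr (τ₃₂ q)
  source := data₁₂.inr '' {p | p.2 ≠ 0}
  target := {q | q.1 ≠ 0}
  map_source' := by
    rintro _ ⟨p, hp, rfl⟩
    simpa [τ₂₃] using hp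
  map_target' q hq := ⟨τ₃₂ q, by simpa [τ₃₂] using hq, rfl⟩
  left_inv' := by
    rintro _ ⟨p, hp, rfl⟩
    simp only [glue₃Fun_inr]
    rw [τ₃₂_τ₂₃ hp]
  right_inv' q hq := by
    simp only [glue₃Fun_inr]
    exact τ₂₃_τ₃₂ hq
  open_source := data₁₂.isOpenMap_inr _ (isOpen_ne_fun continuous_snd continuous_const)
  open_target := isOpen_ne_fun continuous_fst continuous_const
  continuousOn_toFun := by
    rintro _ ⟨p, hp, rfl⟩
    refine ContinuousAt.continuousWithinAt ?_
    rw [← data₁₂.isOpenEmbedding_inr.continuousAt_iff]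
    exact (contDiffAt_τ₂₃ hp).continuousAt
  continuousOn_invFun := fun q hq =>
    (data₁₂.continuous_inr.continuousAt.comp (contDiffAt_τ₃₂ hq).continuousAt).continuousWithinAt

/-- The formula of `glue₃`. [folklore] -/
@[simp] theorem glue₃_apply (v : V₁₂) : glue₃ v = glue₃Fun v := rfl

/-- The formula of `glue₃.symm`. [folklore] -/
@[simp] theorem glue₃_symm_apply (q : ℂ × ℂ) : glue₃.symm q = data₁₂.inr (τ₃₂ q) := rfl

/-- The source of `glue₃`. [folklore] -/
theorem glue₃_source : glue₃.source = data₁₂.inr '' {p : ℂ × ℂ | p.2 ≠ 0} := rfl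

/-- The target of `glue₃`. [folklore] -/
@[simp] theorem glue₃_target : glue₃.target = {q : ℂ × ℂ | q.1 ≠ 0} := rfl

/-- Membership in the source of `glue₃` for points of `U₂`. [folklore] -/
theorem inr_mem_glue₃_source_iff {p : ℂ × ℂ} : data₁₂.inr p ∈ glue₃.source ↔ p.2 ≠ 0 := by
  rw [glue₃_source, data₁₂.inr_injective.mem_set_image]
  rfl

/-- Membership in the source of `glue₃` for points of `U₁`: `z ≠ 0` and `w ≠ 0`. [folklore] -/
theorem inl_mem_glue₃_source_iff {p : ℂ × ℂ} :
    data₁₂.inl p ∈ glue₃.source ↔ p.1 ≠ 0 ∧ p.2 ≠ 0 := by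
  constructor
  · rintro ⟨q, hq, hqp⟩
    obtain ⟨hp, rfl⟩ := (inl_eq_inr₁₂_iff p q).1 hqp.symm
    refine ⟨hp, fun h => hq ?_⟩
    simp [τ₁₂, h]
  · rintro ⟨h1, h2⟩
    rw [inl_eq_inr₁₂ h1, inr_mem_glue₃_source_iff]
    exact mul_ne_zero h1 h2

/-- `glue₃` is smooth on its source: at `inr (u, m)` it descends from the smooth `τ₂₃`.
[folklore] -/
theorem contMDiffOn_glue₃ : ContMDiffOn 𝓘(ℝ, ℂ × ℂ) 𝓘(ℝ, ℂ × ℂ) ∞ glue₃ glue₃.source := by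
  rintro _ ⟨p, hp, rfl⟩
  refine ContMDiffAt.contMDiffWithinAt ?_
  exact contMDiffAt_of_comp_isImmersionAt (data₁₂.isSmoothEmbedding_inr.isImmersion.isImmersionAt p)
    data₁₂.isOpenMap_inr (contDiffAt_τ₂₃ hp).contMDiffAt (fun q => rfl)

/-- `glue₃.symm` is smooth on its target. [folklore] -/
theorem contMDiffOn_glue₃_symm :
    ContMDiffOn 𝓘(ℝ, ℂ × ℂ) 𝓘(ℝ, ℂ × ℂ) ∞ glue₃.symm glue₃.target := fun q hq =>
  (data₁₂.contMDiff_inr.contMDiffAt.comp q (contDiffAt_τ₃₂ hq).contMDiffAt).contMDiffWithinAt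

/-- The gluing datum of `(U₁ ∪ U₂) ∪ U₃`. [folklore] -/
def data₃ : SmoothGlueData 𝓘(ℝ, ℂ × ℂ) 𝓘(ℝ, ℂ × ℂ) V₁₂ (ℂ × ℂ) (ℂ × ℂ) where
  glue := glue₃
  contMDiffOn_glue := contMDiffOn_glue₃
  contMDiffOn_glue_symm := contMDiffOn_glue₃_symm
  linA := ContinuousLinearEquiv.refl ℝ _
  linB := ContinuousLinearEquiv.refl ℝ _

/-- **The toric model** `Ṽ = U₁ ∪ U₂ ∪ U₃` of `Bl_p(ℂℙ¹ × ℂ)`, a smooth real 4-manifold modelled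
on `ℂ × ℂ`. [folklore] -/
abbrev Model : Type := data₃.Glued

end ToricBlowup

/-- A subset of `(A ∪_glue B) × Y` is closed as soon as its traces on the two pieces
`inl(A) × Y`, `inr(B) × Y` (pulled back to `A × Y`, `B × Y`) are closed: its complement is the
union of the images of the (open) complements under the open maps `inl × id`, `inr × id`.
[folklore] -/
theorem SmoothGlueData.isClosed_of_preimage_inl_inr
    {E_A H_A E_B H_B : Type*} [NormedAddCommGroup E_A] [NormedSpace ℝ E_A] [TopologicalSpace H_A]
    [NormedAddCommGroup E_B] [NormedSpace ℝ E_B] [TopologicalSpace H_B]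
    {I_A : ModelWithCorners ℝ E_A H_A} {I_B : ModelWithCorners ℝ E_B H_B}
    {A : Type*} [TopologicalSpace A] [ChartedSpace H_A A]
    {B : Type*} [TopologicalSpace B] [ChartedSpace H_B B]
    {E_P : Type*} [NormedAddCommGroup E_P] [NormedSpace ℝ E_P]
    (d : SmoothGlueData I_A I_B A B E_P) {Y : Type*} [TopologicalSpace Y] {s : Set (d.Glued × Y)}
    (hA : IsClosed ((fun q : A × Y => (d.inl q.1, q.2)) ⁻¹' s))
    (hB : IsClosed ((fun q : B × Y => (d.inr q.1, q.2)) ⁻¹' s)) : IsClosed s := by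
  rw [← isOpen_compl_iff]
  have h : sᶜ = (fun q : A × Y => (d.inl q.1, q.2)) '' ((fun q : A × Y => (d.inl q.1, q.2)) ⁻¹' s)ᶜ
      ∪ (fun q : B × Y => (d.inr q.1, q.2)) '' ((fun q : B × Y => (d.inr q.1, q.2)) ⁻¹' s)ᶜ := by
    ext ⟨x, y⟩
    simp only [mem_compl_iff, mem_union, mem_image, mem_preimage, Prod.mk.injEq, Prod.exists]
    constructor
    · intro hxy
      rcases d.exists_inl_or_inr x with ⟨a, rfl⟩ | ⟨b, rfl⟩
      · exact Or.inl ⟨a, y, hxy, rfl, rfl⟩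
      · exact Or.inr ⟨b, y, hxy, rfl, rfl⟩
    · rintro (⟨a, y', h, rfl, rfl⟩ | ⟨b, y', h, rfl, rfl⟩) <;> exact h
  rw [h]
  have hoA : IsOpenMap (fun q : A × Y => (d.inl q.1, q.2)) := d.isOpenMap_inl.prodMap IsOpenMap.id
  have hoB : IsOpenMap (fun q : B × Y => (d.inr q.1, q.2)) := d.isOpenMap_inr.prodMap IsOpenMap.id
  exact (hoA _ hA.isOpen_compl).union (hoB _ hB.isOpen_compl)

namespace ToricBlowup

/-- The graph of the second gluing map is closed: its traces are the algebraic sets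
`{k z w = 1, w' = w}` on `U₁ × U₃` and `{k m = 1, w' = m u}` on `U₂ × U₃`; hence the toric
model is Hausdorff. [folklore] -/
instance instT2SpaceModel : T2Space Model := by
  apply data₃.t2Space_of_isClosed_graph
  apply data₁₂.isClosed_of_preimage_inl_inr
  · have h : (fun q : (ℂ × ℂ) × (ℂ × ℂ) => (data₁₂.inl q.1, q.2)) ⁻¹'
        {q : V₁₂ × (ℂ × ℂ) | q.1 ∈ data₃.glue.source ∧ data₃.glue q.1 = q.2} =
        {q | q.2.1 * (q.1.1 * q.1.2) = 1 ∧ q.2.2 = q.1.2} := by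
      ext ⟨⟨z, w⟩, ⟨k, w'⟩⟩
      simp only [mem_preimage, mem_setOf_eq, data₃, inl_mem_glue₃_source_iff, ne_eq, glue₃_apply,
        glue₃Fun_inl, Prod.mk.injEq]
      constructor
      · rintro ⟨⟨hz, hw⟩, rfl, rfl⟩
        exact ⟨inv_mul_cancel₀ (mul_ne_zero hz hw), rfl⟩
      · rintro ⟨h1, h2⟩
        have hzw : z * w ≠ 0 := right_ne_zero_of_mul_eq_one h1
        exact ⟨⟨left_ne_zero_of_mul hzw, right_ne_zero_of_mul hzw⟩,
          (eq_inv_of_mul_eq_one_left h1).symm, h2.symm⟩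
    rw [h]
    exact (isClosed_eq (by fun_prop) continuous_const).inter (isClosed_eq (by fun_prop) (by fun_prop))
  · have h : (fun q : (ℂ × ℂ) × (ℂ × ℂ) => (data₁₂.inr q.1, q.2)) ⁻¹'
        {q : V₁₂ × (ℂ × ℂ) | q.1 ∈ data₃.glue.source ∧ data₃.glue q.1 = q.2} =
        {q | q.2.1 * q.1.2 = 1 ∧ q.2.2 = q.1.2 * q.1.1} := by
      ext ⟨⟨u, m⟩, ⟨k, w'⟩⟩
      simp only [mem_preimage, mem_setOf_eq, data₃, inr_mem_glue₃_source_iff, ne_eq, glue₃_apply,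
        glue₃Fun_inr, τ₂₃, Prod.mk.injEq]
      constructor
      · rintro ⟨hm, rfl, rfl⟩
        exact ⟨inv_mul_cancel₀ hm, rfl⟩
      · rintro ⟨h1, h2⟩
        exact ⟨right_ne_zero_of_mul_eq_one h1, (eq_inv_of_mul_eq_one_left h1).symm, h2.symm⟩
    rw [h]
    exact (isClosed_eq (by fun_prop) continuous_const).inter (isClosed_eq (by fun_prop) (by fun_prop))

/-! ### The three toric charts -/

/-- The first toric chart `U₁ → Ṽ`, coordinates `(z, w)`. [folklore] -/
def Φ₁ (p : ℂ × ℂ) : Model := data₃.inl (data₁₂.inl p)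

/-- The second toric chart `U₂ → Ṽ`, coordinates `(u, m) = (z⁻¹, z w)`; `{u = 0}` is the
exceptional curve. [folklore] -/
def Φ₂ (p : ℂ × ℂ) : Model := data₃.inl (data₁₂.inr p)

/-- The third toric chart `U₃ → Ṽ`, coordinates `(k, w) = ((z w)⁻¹, w)`; `{w = 0}` is the
exceptional curve, `{k = 0}` the proper transform of the fibre `{z = ∞}`. [folklore] -/
def Φ₃ (p : ℂ × ℂ) : Model := data₃.inr p

/-- `Φ₁` is an open smooth embedding. [folklore] -/
theorem isSmoothEmbedding_Φ₁ : Manifold.IsSmoothEmbedding 𝓘(ℝ, ℂ × ℂ) 𝓘(ℝ, ℂ × ℂ) ∞ Φ₁ :=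
  data₃.isSmoothEmbedding_inl_comp data₁₂.isSmoothEmbedding_inl

/-- `Φ₂` is an open smooth embedding. [folklore] -/
theorem isSmoothEmbedding_Φ₂ : Manifold.IsSmoothEmbedding 𝓘(ℝ, ℂ × ℂ) 𝓘(ℝ, ℂ × ℂ) ∞ Φ₂ :=
  data₃.isSmoothEmbedding_inl_comp data₁₂.isSmoothEmbedding_inr

/-- `Φ₃` is an open smooth embedding. [folklore] -/
theorem isSmoothEmbedding_Φ₃ : Manifold.IsSmoothEmbedding 𝓘(ℝ, ℂ × ℂ) 𝓘(ℝ, ℂ × ℂ) ∞ Φ₃ :=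
  data₃.isSmoothEmbedding_inr

/-- `Φ₁` is an open map. [folklore] -/
theorem isOpenMap_Φ₁ : IsOpenMap Φ₁ := data₃.isOpenMap_inl.comp data₁₂.isOpenMap_inl

/-- `Φ₂` is an open map. [folklore] -/
theorem isOpenMap_Φ₂ : IsOpenMap Φ₂ := data₃.isOpenMap_inl.comp data₁₂.isOpenMap_inr

/-- `Φ₃` is an open map. [folklore] -/
theorem isOpenMap_Φ₃ : IsOpenMap Φ₃ := data₃.isOpenMap_inr

/-- `Φ₁` is injective. [folklore] -/
theorem Φ₁_injective : Injective Φ₁ := data₃.inl_injective.comp data₁₂.inl_injective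

/-- `Φ₂` is injective. [folklore] -/
theorem Φ₂_injective : Injective Φ₂ := data₃.inl_injective.comp data₁₂.inr_injective

/-- `Φ₃` is injective. [folklore] -/
theorem Φ₃_injective : Injective Φ₃ := data₃.inr_injective

/-- The range of `Φ₁` is open. [folklore] -/
theorem isOpen_range_Φ₁ : IsOpen (range Φ₁) := isOpenMap_Φ₁.isOpen_range

/-- The range of `Φ₂` is open. [folklore] -/
theorem isOpen_range_Φ₂ : IsOpen (range Φ₂) := isOpenMap_Φ₂.isOpen_range

/-- The range of `Φ₃` is open. [folklore] -/
theorem isOpen_range_Φ₃ : IsOpen (range Φ₃) := isOpenMap_Φ₃.isOpen_range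

/-- `Φ₁` is smooth. [folklore] -/
theorem contMDiff_Φ₁ : ContMDiff 𝓘(ℝ, ℂ × ℂ) 𝓘(ℝ, ℂ × ℂ) ∞ Φ₁ := isSmoothEmbedding_Φ₁.contMDiff

/-- `Φ₂` is smooth. [folklore] -/
theorem contMDiff_Φ₂ : ContMDiff 𝓘(ℝ, ℂ × ℂ) 𝓘(ℝ, ℂ × ℂ) ∞ Φ₂ := isSmoothEmbedding_Φ₂.contMDiff

/-- `Φ₃` is smooth. [folklore] -/
theorem contMDiff_Φ₃ : ContMDiff 𝓘(ℝ, ℂ × ℂ) 𝓘(ℝ, ℂ × ℂ) ∞ Φ₃ := isSmoothEmbedding_Φ₃.contMDiff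

/-- **The three toric charts cover the model.** [folklore] -/
theorem exists_Φ_eq (v : Model) : (∃ p, Φ₁ p = v) ∨ (∃ p, Φ₂ p = v) ∨ ∃ p, Φ₃ p = v := by
  rcases data₃.exists_inl_or_inr v with ⟨x, rfl⟩ | ⟨q, rfl⟩
  · rcases data₁₂.exists_inl_or_inr x with ⟨p, rfl⟩ | ⟨p, rfl⟩
    · exact Or.inl ⟨p, rfl⟩
    · exact Or.inr (Or.inl ⟨p, rfl⟩)
  · exact Or.inr (Or.inr ⟨q, rfl⟩)

/-- The cover by the three charts, as an equality of sets. [folklore] -/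
theorem range_Φ₁_union : range Φ₁ ∪ range Φ₂ ∪ range Φ₃ = univ :=
  eq_univ_of_forall fun v => by
    rcases exists_Φ_eq v with h | h | h
    · exact Or.inl (Or.inl h)
    · exact Or.inl (Or.inr h)
    · exact Or.inr h

/-- **Transition `U₁ → U₂`**: `Φ₁ (z, w) = Φ₂ (z⁻¹, z w)` for `z ≠ 0`. [folklore] -/
theorem Φ₁_eq_Φ₂ {p : ℂ × ℂ} (hp : p.1 ≠ 0) : Φ₁ p = Φ₂ (τ₁₂ p) :=
  congrArg data₃.inl (inl_eq_inr₁₂ hp)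

/-- **Transition `U₂ → U₃`**: `Φ₂ (u, m) = Φ₃ (m⁻¹, m u)` for `m ≠ 0`. [folklore] -/
theorem Φ₂_eq_Φ₃ {p : ℂ × ℂ} (hp : p.2 ≠ 0) : Φ₂ p = Φ₃ (τ₂₃ p) :=
  (data₃.inr_glue (show data₁₂.inr p ∈ data₃.glue.source from inr_mem_glue₃_source_iff.2 hp)).symm

/-- **Transition `U₃ → U₂`**: `Φ₃ (k, w) = Φ₂ (k w, k⁻¹)` for `k ≠ 0`. [folklore] -/
theorem Φ₃_eq_Φ₂ {q : ℂ × ℂ} (hq : q.1 ≠ 0) : Φ₃ q = Φ₂ (τ₃₂ q) :=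
  (data₃.inl_glue_symm (show q ∈ data₃.glue.target from hq)).symm

/-- **Transition `U₁ → U₃`**: `Φ₁ (z, w) = Φ₃ ((z w)⁻¹, w)` for `z ≠ 0`, `w ≠ 0`. [folklore] -/
theorem Φ₁_eq_Φ₃ {p : ℂ × ℂ} (h1 : p.1 ≠ 0) (h2 : p.2 ≠ 0) : Φ₁ p = Φ₃ ((p.1 * p.2)⁻¹, p.2) := by
  have hs : data₁₂.inl p ∈ data₃.glue.source := inl_mem_glue₃_source_iff.2 ⟨h1, h2⟩
  exact (data₃.inr_glue hs).symm

/-- The identification between the charts `U₁` and `U₂`. [folklore] -/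
theorem Φ₁_eq_Φ₂_iff (p q : ℂ × ℂ) : Φ₁ p = Φ₂ q ↔ p.1 ≠ 0 ∧ q = τ₁₂ p := by
  rw [Φ₁, Φ₂, data₃.inl_injective.eq_iff, inl_eq_inr₁₂_iff]

/-- The identification between the charts `U₂` and `U₃`. [folklore] -/
theorem Φ₂_eq_Φ₃_iff (p q : ℂ × ℂ) : Φ₂ p = Φ₃ q ↔ p.2 ≠ 0 ∧ q = τ₂₃ p := by
  rw [Φ₂, Φ₃, data₃.inl_eq_inr_iff]
  exact (inr_mem_glue₃_source_iff).and eq_comm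

/-- The identification between the charts `U₁` and `U₃`. [folklore] -/
theorem Φ₁_eq_Φ₃_iff (p q : ℂ × ℂ) :
    Φ₁ p = Φ₃ q ↔ (p.1 ≠ 0 ∧ p.2 ≠ 0) ∧ q = ((p.1 * p.2)⁻¹, p.2) := by
  rw [Φ₁, Φ₃, data₃.inl_eq_inr_iff]
  exact (inl_mem_glue₃_source_iff).and eq_comm

/-- The exceptional curve in the chart `U₂` is `{u = 0}`: such points are not in `U₁`. [folklore] -/
theorem Φ₂_mem_range_Φ₁_iff (q : ℂ × ℂ) : Φ₂ q ∈ range Φ₁ ↔ q.1 ≠ 0 := by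
  constructor
  · rintro ⟨p, hp⟩
    obtain ⟨h, rfl⟩ := (Φ₁_eq_Φ₂_iff p q).1 hp
    simpa [τ₁₂] using h
  · intro h
    exact ⟨τ₁₂ q, by rw [Φ₁_eq_Φ₂ (show (τ₁₂ q).1 ≠ 0 by simpa [τ₁₂] using h), τ₁₂_τ₁₂ h]⟩

/-- A point of `U₃` lies in `U₁` iff `k ≠ 0` and `w ≠ 0`. [folklore] -/
theorem Φ₃_mem_range_Φ₁_iff (q : ℂ × ℂ) : Φ₃ q ∈ range Φ₁ ↔ q.1 ≠ 0 ∧ q.2 ≠ 0 := by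
  constructor
  · rintro ⟨p, hp⟩
    obtain ⟨⟨h1, h2⟩, rfl⟩ := (Φ₁_eq_Φ₃_iff p q).1 hp
    exact ⟨inv_ne_zero (mul_ne_zero h1 h2), h2⟩
  · rintro ⟨h1, h2⟩
    refine ⟨((q.1 * q.2)⁻¹, q.2), ?_⟩
    rw [Φ₁_eq_Φ₃ (p := ((q.1 * q.2)⁻¹, q.2)) (inv_ne_zero (mul_ne_zero h1 h2)) h2]
    dsimp only
    rw [mul_inv_rev, inv_inv, mul_comm q.1 q.2, inv_mul_cancel_left₀ h2]

/-- A point of `U₃` lies in `U₂` iff `k ≠ 0`. [folklore] -/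
theorem Φ₃_mem_range_Φ₂_iff (q : ℂ × ℂ) : Φ₃ q ∈ range Φ₂ ↔ q.1 ≠ 0 := by
  constructor
  · rintro ⟨p, hp⟩
    obtain ⟨h, rfl⟩ := (Φ₂_eq_Φ₃_iff p q).1 hp
    simpa [τ₂₃] using h
  · intro h
    exact ⟨τ₃₂ q, (Φ₃_eq_Φ₂ h).symm⟩

/-! ### The monomial involution -/

/-- The involution on `U₁ ∪ U₂`: `inl (z, w) ↦ Φ₃ (z, w)`, `inr (u, m) ↦ Φ₂ (m, u)`. [folklore] -/
def Ψ₁₂ : V₁₂ → Model :=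
  data₁₂.lift Φ₃ (fun p => Φ₂ p.swap) (by
    rintro ⟨z, w⟩ hz
    change z ≠ 0 at hz
    change Φ₃ (z, w) = Φ₂ (z * w, z⁻¹)
    rw [Φ₂_eq_Φ₃ (show (z * w, z⁻¹).2 ≠ 0 from inv_ne_zero hz)]
    simp only [τ₂₃, inv_inv]
    congr 1
    field_simp)

/-- **The monomial involution** `Ψ : Ṽ → Ṽ`, `(z, w) ↦ ((z w)⁻¹, w)` on the torus: it maps the
point of `U₁` with coordinates `(z, w)` to the point of `U₃` with the same coordinates and vice
versa, and swaps the coordinates of `U₂` (the automorphism `[[-1,-1],[0,1]]` of the fan).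
[folklore] -/
def Ψ : Model → Model :=
  data₃.lift Ψ₁₂ Φ₁ (by
    rintro x ⟨⟨u, m⟩, hm, rfl⟩
    change m ≠ 0 at hm
    change Φ₂ (m, u) = Φ₁ (m⁻¹, m * u)
    rw [Φ₁_eq_Φ₂ (show (m⁻¹, m * u).1 ≠ 0 from inv_ne_zero hm)]
    simp only [τ₁₂, inv_inv]
    congr 1
    field_simp)

/-- `Ψ` on the first chart: `Ψ (Φ₁ p) = Φ₃ p`. [folklore] -/
@[simp] theorem Ψ_Φ₁ (p : ℂ × ℂ) : Ψ (Φ₁ p) = Φ₃ p := rfl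

/-- `Ψ` on the second chart: `Ψ (Φ₂ (u, m)) = Φ₂ (m, u)`. [folklore] -/
@[simp] theorem Ψ_Φ₂ (p : ℂ × ℂ) : Ψ (Φ₂ p) = Φ₂ p.swap := rfl

/-- `Ψ` on the third chart: `Ψ (Φ₃ p) = Φ₁ p`. [folklore] -/
@[simp] theorem Ψ_Φ₃ (p : ℂ × ℂ) : Ψ (Φ₃ p) = Φ₁ p := rfl

/-- **`Ψ` is an involution.** [folklore] -/
theorem Ψ_Ψ (v : Model) : Ψ (Ψ v) = v := by
  rcases exists_Φ_eq v with ⟨p, rfl⟩ | ⟨p, rfl⟩ | ⟨p, rfl⟩ <;> simp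

/-- `Ψ` is an involution (functional form). [folklore] -/
theorem involutive_Ψ : Involutive Ψ := Ψ_Ψ

/-- The torus formula: `Ψ (Φ₁ (z, w)) = Φ₁ ((z w)⁻¹, w)` for `z ≠ 0`, `w ≠ 0`. [folklore] -/
theorem Ψ_Φ₁_of_ne_zero {p : ℂ × ℂ} (h1 : p.1 ≠ 0) (h2 : p.2 ≠ 0) :
    Ψ (Φ₁ p) = Φ₁ ((p.1 * p.2)⁻¹, p.2) := by
  rw [Ψ_Φ₁, Φ₁_eq_Φ₃ (p := ((p.1 * p.2)⁻¹, p.2)) (inv_ne_zero (mul_ne_zero h1 h2)) h2]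
  dsimp only
  rw [mul_inv_rev, inv_inv, mul_comm p.1 p.2, inv_mul_cancel_left₀ h2]

/-- The coordinate swap of `ℂ × ℂ` is smooth. [folklore] -/
theorem contDiff_swap : ContDiff ℝ ∞ (Prod.swap : ℂ × ℂ → ℂ × ℂ) :=
  contDiff_snd.prodMk contDiff_fst

/-- **`Ψ` is smooth**: on each toric chart it is another toric chart composed with a linear map.
[folklore] -/
theorem contMDiff_Ψ : ContMDiff 𝓘(ℝ, ℂ × ℂ) 𝓘(ℝ, ℂ × ℂ) ∞ Ψ := by
  intro v
  rcases exists_Φ_eq v with ⟨p, rfl⟩ | ⟨p, rfl⟩ | ⟨p, rfl⟩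
  · exact contMDiffAt_of_comp_isImmersionAt (isSmoothEmbedding_Φ₁.isImmersion.isImmersionAt p)
      isOpenMap_Φ₁ contMDiff_Φ₃.contMDiffAt Ψ_Φ₁
  · exact contMDiffAt_of_comp_isImmersionAt (isSmoothEmbedding_Φ₂.isImmersion.isImmersionAt p)
      isOpenMap_Φ₂ (contMDiff_Φ₂.comp contDiff_swap.contMDiff).contMDiffAt Ψ_Φ₂
  · exact contMDiffAt_of_comp_isImmersionAt (isSmoothEmbedding_Φ₃.isImmersion.isImmersionAt p)
      isOpenMap_Φ₃ contMDiff_Φ₁.contMDiffAt Ψ_Φ₃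

/-- **The monomial involution as a diffeomorphism** of the toric model. [folklore] -/
def ΨDiffeo : Model ≃ₘ⟮𝓘(ℝ, ℂ × ℂ), 𝓘(ℝ, ℂ × ℂ)⟯ Model where
  toFun := Ψ
  invFun := Ψ
  left_inv := Ψ_Ψ
  right_inv := Ψ_Ψ
  contMDiff_toFun := contMDiff_Ψ
  contMDiff_invFun := contMDiff_Ψ

/-- The underlying map of `ΨDiffeo` is `Ψ`. [folklore] -/
@[simp] theorem coe_ΨDiffeo : ⇑ΨDiffeo = Ψ := rfl

end ToricBlowup

end Literature.Topology.FourManifolds
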